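import Summits.Ventures.HodgeRepro2.T6N3Interface

/-!
# T6N3SideA — Proposition N* for one side, in kernel (TIER5 §N3.4: N3.L1–N3.L7 and the proof of N*)

Cell pub-hodge-repro2, Tier 6 (README §10), seat t6-p3 (N3 owner, M2). Over the datum `N3Side`
(T6N3Datum) and the interface Props of T6N3Interface as BINDERS, this file proves

  `propN_of_hyp : X.hypI → X.hypII → ∃ φa φb, ∃ ψ ∈ X.σ ⊓ τiso, X.ell φa φb ψ ≠ 0`

= «(i) ∧ (ii) ⟹ ℓ_A^σ ≢ 0 on σ^τ for a single product of vertex forms» (N3.1, both sides — the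
statement is side-generic; `N3A_main` / `N3B_main` instantiate it on `𝒟.A` / `𝒟.B`). The kernel content
is the finite-dimensional Hilbert-space argument of N3.4: the decomposition of `Π(π₀)^{K,τ′}` along
the copies (N3.2(e)), the Riesz representative `p` of the toric period (N3.L6), the `K`-average and
the `H(𝔸_f)`-span of a fixed vector (N3.L7, row T7), the transfer of (i) between copies
(N3.L4 copy independence) and the cross-copy orthogonality of lifts (N3.L4), then the seam (N3.2)
and the adjoint identity (N3.L2) to read `ℓ_A(Θ(p, φ′)) = ‖Θ(p, φ′)‖² > 0`, and the pure-tensor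
extraction (N3.2(c)).

§8(d): uses an L-value-free non-vanishing device: NO.
-/

namespace Summit.Ventures.HodgeRepro2.T6.N3Side

open scoped InnerProductSpace

variable {LG : Type} [NormedAddCommGroup LG] [InnerProductSpace ℂ LG] {Gf : Type} [Group Gf]
  (X : N3Side LG Gf)

/-- The image of the `j`-th copy `π₀ ⊗ m_j ⊂ L²([H])`. -/
abbrev copyRange (j : Fin X.m₀) : Submodule ℂ X.LH :=
  LinearMap.range (X.copy j).toLinearMap

/-- `copy j v` lies in the `j`-th copy. -/
lemma copy_mem_copyRange (j : Fin X.m₀) (v : X.π₀) : (X.copy j v : X.LH) ∈ X.copyRange j :=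
  LinearMap.mem_range_self _ _

/-- Every element of the isotypic component `Π(π₀)` is a sum of vectors from the copies (N3.2(e)). -/
lemma exists_decomp_of_mem_isotypic {p : X.LH} (hp : p ∈ X.isotypic) :
    ∃ v : Fin X.m₀ → X.π₀, p = ∑ j, (X.copy j (v j) : X.LH) := by
  rw [isotypic, Submodule.mem_iSup_iff_exists_finsupp] at hp
  obtain ⟨f, hf, hsum⟩ := hp
  choose v hv using fun j => LinearMap.mem_range.mp (hf j)
  refine ⟨v, ?_⟩
  rw [← hsum, Finsupp.sum_fintype _ _ (fun _ => rfl)]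
  exact Finset.sum_congr rfl fun j _ => (hv j).symm

/-- Orthogonality of the copies, on their images. -/
lemma inner_eq_zero_of_mem_copyRange (hO : X.CopiesOrthogonal) {i j : Fin X.m₀} (hij : i ≠ j)
    {x y : X.LH} (hx : x ∈ X.copyRange i) (hy : y ∈ X.copyRange j) : ⟪x, y⟫_ℂ = 0 := by
  obtain ⟨v, rfl⟩ := hx
  obtain ⟨w, rfl⟩ := hy
  exact hO i j hij v w

/-- Uniqueness of the decomposition along the (orthogonal) copies. -/
lemma eq_of_sum_eq_sum (hO : X.CopiesOrthogonal) {x y : Fin X.m₀ → X.LH}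
    (hx : ∀ j, x j ∈ X.copyRange j) (hy : ∀ j, y j ∈ X.copyRange j)
    (h : ∑ j, x j = ∑ j, y j) : ∀ j, x j = y j := by
  intro i
  have hd : ∀ j, x j - y j ∈ X.copyRange j := fun j => sub_mem (hx j) (hy j)
  have hsum : ∑ j, (x j - y j) = 0 := by rw [Finset.sum_sub_distrib, h, sub_self]
  have h0 : ⟪x i - y i, x i - y i⟫_ℂ = 0 := by
    have h1 : ⟪x i - y i, ∑ j, (x j - y j)⟫_ℂ = 0 := by rw [hsum, inner_zero_right]
    rw [inner_sum, Finset.sum_eq_single i] at h1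
    · exact h1
    · intro j _ hji
      exact X.inner_eq_zero_of_mem_copyRange hO (Ne.symm hji) (hd i) (hd j)
    · intro h; exact absurd (Finset.mem_univ i) h
  exact sub_eq_zero.mp (inner_self_eq_zero.mp h0)

/-- A `K`-fixed vector of `Π(π₀)` has `K`-fixed components along the copies (the copies are
`H(𝔸_f)`-equivariant and orthogonal). -/
lemma copy_mem_Kfix_of_sum (hE : X.CopiesEquivariant) (hO : X.CopiesOrthogonal)
    (v : Fin X.m₀ → X.π₀) (hK : (∑ j, (X.copy j (v j) : X.LH)) ∈ X.Kfix) :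
    ∀ j, (X.copy j (v j) : X.LH) ∈ X.Kfix := by
  intro j k hk
  have h1 : X.R k (∑ j, (X.copy j (v j) : X.LH)) = ∑ j, (X.copy j (v j) : X.LH) := hK k hk
  rw [map_sum] at h1
  refine X.eq_of_sum_eq_sum hO (x := fun j => X.R k (X.copy j (v j)))
    (y := fun j => (X.copy j (v j) : X.LH)) ?_ (fun j => X.copy_mem_copyRange j (v j)) h1 j
  intro j
  obtain ⟨h, hh⟩ := hE j k (v j)
  rw [← hh]
  exact X.copy_mem_copyRange j _

/-- The toric period as a linear functional on `Π(π₀)^{K,τ′}` (N3.L6). -/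
noncomputable def ptorLevel (hC : X.LevelPartCont) : X.levelPart →ₗ[ℂ] ℂ :=
  X.Ptor.comp (Submodule.inclusion hC)

/-- `ptorLevel` evaluates as the toric period of the (continuous) vector `k`. -/
lemma ptorLevel_apply (hC : X.LevelPartCont) (k : X.levelPart) :
    X.ptorLevel hC k = X.Ptor ⟨k, hC k.2⟩ := rfl

/-- The Riesz representative `p = p_{K,τ′}` of the toric period on the finite-dimensional Hilbert space
`Π(π₀)^{K,τ′}` (N3.L6). -/
noncomputable def rieszVec (hF : X.LevelPartFinite) (hC : X.LevelPartCont) : X.levelPart :=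
  haveI : FiniteDimensional ℂ X.levelPart := hF
  haveI : CompleteSpace X.levelPart := FiniteDimensional.complete ℂ X.levelPart
  (InnerProductSpace.toDual ℂ X.levelPart).symm (LinearMap.toContinuousLinearMap (X.ptorLevel hC))

/-- `P_χ(k) = ⟨k, p⟩` on `Π(π₀)^{K,τ′}` (N3.L6), in Mathlib's convention `⟪p, k⟫`. -/
lemma inner_rieszVec (hF : X.LevelPartFinite) (hC : X.LevelPartCont) (k : X.levelPart) :
    ⟪X.rieszVec hF hC, k⟫_ℂ = X.ptorLevel hC k := by
  haveI : FiniteDimensional ℂ X.levelPart := hF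
  haveI : CompleteSpace X.levelPart := FiniteDimensional.complete ℂ X.levelPart
  unfold rieszVec
  rw [InnerProductSpace.toDual_symm_apply]
  rfl

/-- `p ≠ 0` under hypothesis (ii) (N3.4: «By (ii), `p = p_{K,τ′} ≠ 0`»). -/
lemma rieszVec_ne_zero (hF : X.LevelPartFinite) (hC : X.LevelPartCont) (hII : X.hypII) :
    X.rieszVec hF hC ≠ 0 := by
  obtain ⟨k, hk, hPk⟩ := hII
  intro h0
  apply hPk
  have := X.inner_rieszVec hF hC ⟨k, hk⟩
  rw [h0, inner_zero_left, ptorLevel_apply] at this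
  exact this.symm

/-- N3.L7 on one copy: for a non-zero `K`-fixed `τ′`-vector `u` of the `j`-th copy there is a `K`-fixed
Schwartz datum `φ′` with `Θ(u, φ′) ≠ 0`, given hypothesis (i) (transported to the `j`-th copy by the
copy independence of N3.L4). -/
lemma exists_SKfix_theta_ne_zero (hAvg : X.KAverage) (hEq : X.ThetaEquivariant)
    (hSpan : X.SpanOfFixedVector) (hIncl : X.CopiesIncl) (hTau : X.CopiesTauType)
    (hInd : X.CopyIndependence) (hI : X.hypI) (j : Fin X.m₀) {u : X.LH}
    (hu : u ∈ X.copyRange j ⊓ X.Kfix ⊓ X.τ'iso) (hu0 : u ≠ 0) :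
    ∃ φ' ∈ X.SKfix, X.Θ φ' u ≠ 0 := by
  by_cases hcon : ∃ φ' ∈ X.SKfix, X.Θ φ' u ≠ 0
  · exact hcon
  exfalso
  have hall : ∀ φ' ∈ X.SKfix, X.Θ φ' u = 0 := fun φ' hφ' => by
    by_contra h
    exact hcon ⟨φ', hφ', h⟩
  -- every Schwartz datum kills `u` (the `K`-average)
  have hall' : ∀ φ : X.S, X.Θ φ u = 0 := by
    intro φ
    obtain ⟨φ', hφ', hφ'u⟩ := hAvg φ
    rw [← hφ'u u hu.1.2]
    exact hall φ' hφ'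
  -- hence `Θ φ` vanishes on the `H(𝔸_f)`-span of `u` (equivariance) …
  have hker : ∀ φ : X.S,
      Submodule.span ℂ (Set.range fun g : X.Hf => X.R g u) ≤ LinearMap.ker (X.Θ φ) := by
    intro φ
    rw [Submodule.span_le]
    rintro _ ⟨g, rfl⟩
    show X.Θ φ (X.R g u) = 0
    rw [hEq g φ u]
    exact hall' _
  -- … which contains the `τ′`-part of the copy (row T7)
  have hvan : ∀ φ : X.S, ∀ w ∈ X.copyRange j ⊓ X.τ'iso, X.Θ φ w = 0 := by
    intro φ w hw
    exact (hker φ) (hSpan j u hu hu0 hw)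
  -- hypothesis (i), transported to the `j`-th copy
  obtain ⟨f, hf, φ, hφf⟩ := hI
  obtain ⟨j₁, hj₁⟩ := hIncl
  let f' : X.π₀ := ⟨f, hf.1⟩
  have hw : (X.copy j f' : X.LH) ∈ X.copyRange j ⊓ X.τ'iso :=
    ⟨X.copy_mem_copyRange j f', (hTau j f').mpr hf.2⟩
  have h1 : ⟪X.Θ φ (X.copy j f'), X.Θ φ (X.copy j f')⟫_ℂ = ⟪X.Θ φ f, X.Θ φ f⟫_ℂ := by
    rw [hInd j j₁ φ φ f' f', hj₁ f']
  rw [hvan φ _ hw, inner_zero_left] at h1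
  exact hφf (inner_self_eq_zero.mp h1.symm)

/-- PROPOSITION N* FOR ONE SIDE (TIER5 N3.1 / N3.4): hypotheses (i) and (ii) give a single product of
vertex forms whose functional `ℓ^σ` is not identically zero on `σ^τ`. The binders are the interface
Props of T6N3Interface (the [A]-class steps of the record) — every printed input of N3 enters through
them; the argument itself is the one of N3.4 (the proof of Proposition N*, side A). -/
theorem propN_of_hyp (τiso : Submodule ℂ LG)
    (hKC : X.KliftCont) (hSeam : X.Seam hKC) (hAdj : X.Adjoint) (hKL : X.KliftLevel)
    (hKI : X.KliftIsotypic) (hΘσ : X.ThetaMemSigma) (hΘτ : X.ThetaTauType τiso)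
    (hE : X.CopiesEquivariant) (hO : X.CopiesOrthogonal) (hIncl : X.CopiesIncl)
    (hTau : X.CopiesTauType) (hDec : X.TauTypeDecomposes) (hF : X.LevelPartFinite)
    (hC : X.LevelPartCont) (hAvg : X.KAverage) (hEq : X.ThetaEquivariant)
    (hSpan : X.SpanOfFixedVector) (hCO : X.CrossCopyOrthogonal) (hInd : X.CopyIndependence)
    (hTS : X.TensorsSpan) (hI : X.hypI) (hII : X.hypII) :
    ∃ (φa : X.Sa) (φb : X.Sb), ∃ ψ ∈ X.σ ⊓ τiso, X.ell φa φb ψ ≠ 0 := by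
  -- the Riesz vector `p` of the toric period (N3.L6)
  set p := X.rieszVec hF hC with hp_def
  have hp0 : p ≠ 0 := X.rieszVec_ne_zero hF hC hII
  have hpL : (p : X.LH) ∈ X.levelPart := p.2
  -- its decomposition along the copies (N3.2(e)), with `K`-fixed `τ′`-components
  obtain ⟨v, hv⟩ := X.exists_decomp_of_mem_isotypic hpL.1.1
  have hKj : ∀ j, (X.copy j (v j) : X.LH) ∈ X.Kfix :=
    X.copy_mem_Kfix_of_sum hE hO v (hv ▸ hpL.1.2)
  have hτj : ∀ j, (X.copy j (v j) : X.LH) ∈ X.τ'iso := hDec v (hv ▸ hpL.2)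
  -- a non-zero component `p_{j₀}`
  have hex : ∃ j, (X.copy j (v j) : X.LH) ≠ 0 := by
    by_contra hcon
    apply hp0
    have hall : ∀ j, (X.copy j (v j) : X.LH) = 0 := fun j => by
      by_contra h
      exact hcon ⟨j, h⟩
    apply Subtype.ext
    rw [Submodule.coe_zero, hv]
    exact Finset.sum_eq_zero fun j _ => hall j
  obtain ⟨j₀, hj₀⟩ := hex
  have hu : (X.copy j₀ (v j₀) : X.LH) ∈ X.copyRange j₀ ⊓ X.Kfix ⊓ X.τ'iso :=
    ⟨⟨X.copy_mem_copyRange _ _, hKj j₀⟩, hτj j₀⟩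
  -- N3.L7: a `K`-fixed datum `φ′` with `Θ(p_{j₀}, φ′) ≠ 0`
  obtain ⟨φ', hφ', hφ'u⟩ :=
    X.exists_SKfix_theta_ne_zero hAvg hEq hSpan hIncl hTau hInd hI j₀ hu hj₀
  -- `ψ := Θ(p, φ′) ∈ σ^τ`
  have hψσ : X.Θ φ' p ∈ X.σ ⊓ τiso := ⟨hΘσ φ' p hpL.1.1, hΘτ φ' p hpL.2⟩
  -- `ψ ≠ 0` by the cross-copy orthogonality of the lifts (N3.L4)
  have hψu : ⟪X.Θ φ' p, X.Θ φ' (X.copy j₀ (v j₀))⟫_ℂ =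
      ⟪X.Θ φ' (X.copy j₀ (v j₀)), X.Θ φ' (X.copy j₀ (v j₀))⟫_ℂ := by
    rw [show (p : X.LH) = ∑ j, (X.copy j (v j) : X.LH) from hv, map_sum, sum_inner,
      Finset.sum_eq_single j₀]
    · intro j _ hj
      exact hCO j j₀ hj φ' φ' (v j) (v j₀)
    · intro h
      exact absurd (Finset.mem_univ j₀) h
  have hψ0 : X.Θ φ' p ≠ 0 := by
    intro h0
    rw [h0, inner_zero_left] at hψu
    exact hφ'u (inner_self_eq_zero.mp hψu.symm)
  -- the toric period of `K_ψ`: `P_χ(K_ψ) = ⟨K_ψ, p⟩ = ⟨Θ(p, φ′), ψ⟩ = ‖ψ‖²` (N3.L6, N3.L5(c), N3.L2)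
  have hKψ : X.Klift φ' (X.Θ φ' p) ∈ X.levelPart :=
    ⟨⟨hKI φ' hφ' _ hψσ.1, (hKL φ' hφ' _).1⟩, (hKL φ' hφ' _).2⟩
  have hL : X.Ptor ⟨X.Klift φ' (X.Θ φ' p), hKC φ' _⟩ = ⟪X.Θ φ' p, X.Θ φ' p⟫_ℂ := by
    have h1 : X.Ptor ⟨X.Klift φ' (X.Θ φ' p), hKC φ' _⟩ =
        ⟪p, (⟨X.Klift φ' (X.Θ φ' p), hKψ⟩ : X.levelPart)⟫_ℂ :=
      (X.inner_rieszVec hF hC ⟨_, hKψ⟩).symm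
    rw [h1, Submodule.coe_inner]
    exact hAdj φ' p _
  have hL0 : X.Ptor ⟨X.Klift φ' (X.Θ φ' p), hKC φ' _⟩ ≠ 0 := by
    rw [hL]
    exact inner_self_ne_zero.mpr hψ0
  -- the pure-tensor extraction (N3.2(c)): `φ′` is a finite combination of pure tensors and `ℓ` is
  -- linear in the Schwartz datum through the seam (N3.2)
  have hφ'span : φ' ∈ Submodule.span ℂ (Set.range fun q : X.Sa × X.Sb => X.tensor q.1 q.2) :=
    hTS Submodule.mem_top
  obtain ⟨n, c, g, hg⟩ := Submodule.mem_span_set'.mp hφ'span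
  choose q hq using fun i => (g i).2
  -- `Ptor (Klift φ′ ψ) = ∑ c i • ell (q i).1 (q i).2 ψ`
  have hsum : X.Ptor ⟨X.Klift φ' (X.Θ φ' p), hKC φ' _⟩ =
      ∑ i, c i • X.ell (q i).1 (q i).2 (X.Θ φ' p) := by
    have hφ'eq : φ' = ∑ i, c i • X.tensor (q i).1 (q i).2 := by
      rw [← hg]
      exact Finset.sum_congr rfl fun i _ => by
        have h := hq i
        simp only at h
        rw [h]
    have hK : ∀ ψ : LG, X.Klift φ' ψ =
        ∑ i, c i • X.Klift (X.tensor (q i).1 (q i).2) ψ := by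
      intro ψ
      conv_lhs => rw [hφ'eq]
      rw [map_sum, LinearMap.sum_apply]
      exact Finset.sum_congr rfl fun i _ => by rw [map_smul, LinearMap.smul_apply]
    have hsub : (⟨X.Klift φ' (X.Θ φ' p), hKC φ' _⟩ : X.Cont) =
        ∑ i, c i • (⟨X.Klift (X.tensor (q i).1 (q i).2) (X.Θ φ' p), hKC _ _⟩ : X.Cont) := by
      apply Subtype.ext
      rw [Submodule.coe_sum]
      simp only [Submodule.coe_smul]
      exact hK _
    rw [hsub, map_sum]
    exact Finset.sum_congr rfl fun i _ => by rw [map_smul, hSeam]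
  -- some pure tensor already gives `ℓ ≠ 0`
  by_contra hcon
  apply hL0
  rw [hsum]
  refine Finset.sum_eq_zero fun i _ => ?_
  have : X.ell (q i).1 (q i).2 (X.Θ φ' p) = 0 := by
    by_contra h
    exact hcon ⟨(q i).1, (q i).2, X.Θ φ' p, hψσ, h⟩
  rw [this, smul_zero]

end Summit.Ventures.HodgeRepro2.T6.N3Side
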